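import Mathlib
import Literature.Analysis.Fourier.HilbertTransformLineMultiplierL2
import Literature.Analysis.Fourier.HilbertTransformLineSplit
import Literature.Analysis.FunctionSpaces.PlancherelL1L2
import HarnessLib

/-!
# The Hilbert transform is an `L²` isometry on the line (M. Riesz, `p = 2`)

`Literature/Analysis/Fourier`. For a real `f ∈ L¹(ℝ) ∩ L²(ℝ)` whose symmetric principal-value integrand
`t ↦ (f(x−t) − f(x+t))/t` is integrable on `(0,∞)` at almost every `x` (so that the tree's pointwise operator
`hilbertTransform f x = π⁻¹ ∫_{t>0} (f(x−t) − f(x+t))/t dt` of `HilbertTransformLine.lean` is the genuine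
principal value a.e.), the Hilbert transform is square integrable and

  `‖H f‖_{L²(ℝ)} = ‖f‖_{L²(ℝ)}`        (`eLpNorm_hilbertTransform_eq`, `memLp_two_hilbertTransform`)

[cite: Grafakos2014, eq. (5.1.14) («H is an isometry on L²(R)»)]; in particular this holds for every
`f ∈ C¹ ∩ L¹ ∩ L²` (`eLpNorm_hilbertTransform_eq_of_contDiff`, via `integrableOn_symmIntegrand_of_contDiff`).
PROOF (the printed route (5.1.8)–(5.1.14), run on the operator instead of the distribution `W₀`): the truncations
`H_n := H_{1/(n+1), n+1} f` (`hilbertTransformTrunc`) are in `L¹ ∩ L²` and `𝓕 H_n = m_n · 𝓕 f` with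
`|m_n| ≤ 7`, `m_n(k) → −i sgn k` (`HilbertTransformLineMultiplier.lean`); Plancherel on `L¹ ∩ L²`
(`Literature.Analysis.FunctionSpaces.lintegral_enorm_sq_fourierIntegral_eq`) and dominated convergence make
`(H_n)` Cauchy in `L²` with `‖H_n‖₂ → ‖𝓕f‖₂ = ‖f‖₂`; Fatou against the pointwise limit `H_n(x) → Hf(x)`
(`tendsto_hilbertTransformTrunc`) identifies the `L²` limit as `Hf`. No definitions.
MOTIVATION (cell ns-blowup, zone Z3): identity (1a) of the SHEET-ℝ certificate frame
(`HOME/selfsim/SHEET-R-FRAME-NOTE-v2.md` §1: «M. Riesz p = 2; not in the tree as a theorem»), load-bearing for the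
Newton–Kantorovich constants of any ℝ-line profile certificate. WHAT THIS IS NOT: not Navier–Stokes.
-/

namespace Literature.Analysis.Fourier

open _root_.MeasureTheory Set Filter _root_.Complex
open Literature.NumberTheory.ConnesConsani2021 Literature.Analysis.FunctionSpaces
open scoped Real Topology ENNReal FourierTransform

/-! ### Plumbing -/

/-- A real `L²` function is an `L²` function after the embedding `ℝ ↪ ℂ`. [folklore] -/
private theorem memLp_ofReal {g : ℝ → ℝ} (hg : MemLp g 2) : MemLp (fun x => (g x : ℂ)) 2 :=
  MemLp.of_le hg (Complex.continuous_ofReal.comp_aestronglyMeasurable hg.1)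
    (ae_of_all _ fun x => by rw [Complex.norm_real])

/-- Integrability of the Fourier integrand `𝐞(−vw) • a(v)` for `a ∈ L¹`. [folklore] -/
private theorem integrable_fourierChar_smul {a : ℝ → ℂ} (ha : Integrable a) (w : ℝ) :
    Integrable (fun v : ℝ => (𝐞 (-(v * w)) : Circle) • a v) := by
  have hc : Continuous fun v : ℝ => ((𝐞 (-(v * w)) : Circle) : ℂ) :=
    continuous_subtype_val.comp (Real.continuous_fourierChar.comp (by fun_prop))
  have h := ha.bdd_mul hc.aestronglyMeasurable (ae_of_all _ fun v => (Circle.norm_coe _).le)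
  simpa only [Circle.smul_def, smul_eq_mul] using h

/-! ### Cauchy-in-`L²` plus a.e. convergence gives `L²` convergence (Fatou) -/


/-- If `u n → v` a.e., `∫ ‖u n − u m‖ₑ² ≤ 2aₙ + 2aₘ` and `aₙ → 0`, then `∫ ‖u n − v‖ₑ² → 0` (Fatou in `m`).
[folklore] -/
private theorem tendsto_lintegral_sub_sq_of_cauchy {u : ℕ → ℝ → ℂ} {v : ℝ → ℂ} {a : ℕ → ℝ≥0∞}
    (hu : ∀ n, AEStronglyMeasurable (u n) volume)
    (hlim : ∀ᵐ x : ℝ, Tendsto (fun n => u n x) atTop (𝓝 (v x)))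
    (hcau : ∀ n m, (∫⁻ x, ‖u n x - u m x‖ₑ ^ 2) ≤ 2 * a n + 2 * a m)
    (ha : Tendsto a atTop (𝓝 0)) :
    Tendsto (fun n => ∫⁻ x, ‖u n x - v x‖ₑ ^ 2) atTop (𝓝 0) := by
  have h2a : Tendsto (fun n => 2 * a n) atTop (𝓝 0) := by
    simpa using ENNReal.Tendsto.const_mul ha (Or.inr ENNReal.ofNat_ne_top)
  refine tendsto_of_tendsto_of_tendsto_of_le_of_le tendsto_const_nhds h2a (fun _ => zero_le) ?_
  intro n
  show (∫⁻ x, ‖u n x - v x‖ₑ ^ 2) ≤ 2 * a n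
  -- Fatou in `m`
  have hpt : ∀ᵐ x : ℝ, liminf (fun m => ‖u n x - u m x‖ₑ ^ 2) atTop = ‖u n x - v x‖ₑ ^ 2 := by
    filter_upwards [hlim] with x hx
    refine Tendsto.liminf_eq ?_
    have h1 : Tendsto (fun m => ‖u n x - u m x‖ₑ) atTop (𝓝 ‖u n x - v x‖ₑ) :=
      (tendsto_const_nhds.sub hx).enorm
    exact ENNReal.Tendsto.pow h1
  have hF : (∫⁻ x, ‖u n x - v x‖ₑ ^ 2) = ∫⁻ x, liminf (fun m => ‖u n x - u m x‖ₑ ^ 2) atTop :=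
    lintegral_congr_ae (by filter_upwards [hpt] with x hx; exact hx.symm)
  rw [hF]
  refine (lintegral_liminf_le' fun m => (((hu n).sub (hu m)).enorm.pow_const 2)).trans ?_
  have hlim2 : Tendsto (fun m => 2 * a n + 2 * a m) atTop (𝓝 (2 * a n)) := by
    simpa using (tendsto_const_nhds (x := 2 * a n)).add h2a
  rw [← hlim2.liminf_eq]
  exact liminf_le_liminf (Eventually.of_forall fun m => hcau n m)

/-- From `∫ ‖u n − v‖ₑ² → 0`: `‖u n − v‖_{L²} → 0`. [folklore] -/
private theorem tendsto_eLpNorm_sub_of_lintegral {u : ℕ → ℝ → ℂ} {v : ℝ → ℂ}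
    (h : Tendsto (fun n => ∫⁻ x, ‖u n x - v x‖ₑ ^ 2) atTop (𝓝 0)) :
    Tendsto (fun n => eLpNorm (fun x => u n x - v x) 2 volume) atTop (𝓝 0) := by
  have e : ∀ n, eLpNorm (fun x => u n x - v x) 2 volume = (∫⁻ x, ‖u n x - v x‖ₑ ^ 2) ^ (1 / (2 : ℝ)) := by
    intro n
    rw [eLpNorm_eq_lintegral_rpow_enorm_toReal two_ne_zero ENNReal.ofNat_ne_top]
    simp
  simp_rw [e]
  have h0 : (0 : ℝ≥0∞) ^ (1 / (2 : ℝ)) = 0 := ENNReal.zero_rpow_of_pos (by norm_num)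
  rw [← h0]
  exact (ENNReal.continuous_rpow_const.tendsto 0).comp h

/-- If `‖u n − v‖_{L²} → 0` with `v ∈ L²`, then `‖u n‖_{L²} → ‖v‖_{L²}`. [folklore] -/
private theorem tendsto_eLpNorm_of_tendsto_sub {u : ℕ → ℝ → ℂ} {v : ℝ → ℂ}
    (hu : ∀ n, AEStronglyMeasurable (u n) volume) (hv : AEStronglyMeasurable v volume)
    (hvfin : eLpNorm v 2 volume ≠ ⊤)
    (h : Tendsto (fun n => eLpNorm (fun x => u n x - v x) 2 volume) atTop (𝓝 0)) :
    Tendsto (fun n => eLpNorm (u n) 2 volume) atTop (𝓝 (eLpNorm v 2 volume)) := by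
  have h12 : (1 : ℝ≥0∞) ≤ 2 := by norm_num
  have hup : ∀ n, eLpNorm (u n) 2 volume ≤ eLpNorm v 2 volume + eLpNorm (fun x => u n x - v x) 2 volume := by
    intro n
    have : u n = fun x => v x + (u n x - v x) := by funext x; ring
    calc eLpNorm (u n) 2 volume = eLpNorm (fun x => v x + (u n x - v x)) 2 volume := by rw [← this]
      _ ≤ eLpNorm v 2 volume + eLpNorm (fun x => u n x - v x) 2 volume :=
          eLpNorm_add_le hv ((hu n).sub hv) h12
  have hlow : ∀ n, eLpNorm v 2 volume ≤ eLpNorm (u n) 2 volume + eLpNorm (fun x => u n x - v x) 2 volume := by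
    intro n
    have : v = fun x => u n x + (-(u n x - v x)) := by funext x; ring
    calc eLpNorm v 2 volume = eLpNorm (fun x => u n x + (-(u n x - v x))) 2 volume := by rw [← this]
      _ ≤ eLpNorm (u n) 2 volume + eLpNorm (fun x => -(u n x - v x)) 2 volume :=
          eLpNorm_add_le (hu n) ((hu n).sub hv).neg h12
      _ = eLpNorm (u n) 2 volume + eLpNorm (fun x => u n x - v x) 2 volume := by
          congr 1
          have hneg : (fun x => -(u n x - v x)) = -(fun x => u n x - v x) := rfl
          rw [hneg, eLpNorm_neg]
  refine tendsto_of_tendsto_of_tendsto_of_le_of_le (g := fun n => eLpNorm v 2 volume -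
      eLpNorm (fun x => u n x - v x) 2 volume) (h := fun n => eLpNorm v 2 volume +
      eLpNorm (fun x => u n x - v x) 2 volume) ?_ ?_ (fun n => tsub_le_iff_right.2 (hlow n)) hup
  · have := ENNReal.Tendsto.sub (tendsto_const_nhds (x := eLpNorm v 2 volume)) h (Or.inl hvfin)
    simpa using this
  · simpa using (tendsto_const_nhds (x := eLpNorm v 2 volume)).add h

/-! ### The truncation sequence `H_n = H_{1/(n+1), n+1} f` -/

/-- Window endpoints: `0 < 1/(n+1) ≤ n+1`. [folklore] -/
private theorem window_pos (n : ℕ) : (0 : ℝ) < 1 / ((n : ℝ) + 1) := by positivity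

/-- Window endpoints: `1/(n+1) ≤ n+1`. [folklore] -/
private theorem window_le (n : ℕ) : 1 / ((n : ℝ) + 1) ≤ (n : ℝ) + 1 := by
  rw [div_le_iff₀ (by positivity)]
  have h0 : (0 : ℝ) ≤ n := Nat.cast_nonneg n
  nlinarith

/-- **Plancherel for differences of truncations.** With `H_n = H_{1/(n+1),n+1} f` and multipliers `m_n`:
`∫ ‖H_n − H_m‖ₑ² = ∫ ‖(m_n − m_m)·𝓕f‖ₑ²`. [folklore] -/
private theorem lintegral_trunc_sub_trunc_sq {f : ℝ → ℝ} (hf : Integrable f) (hf2 : MemLp f 2) (n m : ℕ) :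
    (∫⁻ x, ‖(hilbertTransformTrunc (1 / ((n : ℝ) + 1)) ((n : ℝ) + 1) f x : ℂ) -
        (hilbertTransformTrunc (1 / ((m : ℝ) + 1)) ((m : ℝ) + 1) f x : ℂ)‖ₑ ^ 2) =
      ∫⁻ k, ‖((((-(2 / π * (sinIntegral (2 * π * k * ((n : ℝ) + 1)) -
          sinIntegral (2 * π * k * (1 / ((n : ℝ) + 1)))))) : ℝ) : ℂ) * I -
        (((-(2 / π * (sinIntegral (2 * π * k * ((m : ℝ) + 1)) -
          sinIntegral (2 * π * k * (1 / ((m : ℝ) + 1)))))) : ℝ) : ℂ) * I) *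
        𝓕 (fun x => (f x : ℂ)) k‖ₑ ^ 2 := by
  have hIn : Integrable (fun x => (hilbertTransformTrunc (1 / ((n : ℝ) + 1)) ((n : ℝ) + 1) f x : ℂ)) :=
    (integrable_hilbertTransformTrunc hf (window_pos n)).ofReal
  have hIm : Integrable (fun x => (hilbertTransformTrunc (1 / ((m : ℝ) + 1)) ((m : ℝ) + 1) f x : ℂ)) :=
    (integrable_hilbertTransformTrunc hf (window_pos m)).ofReal
  have h2n : MemLp (fun x => (hilbertTransformTrunc (1 / ((n : ℝ) + 1)) ((n : ℝ) + 1) f x : ℂ)) 2 :=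
    memLp_ofReal (memLp_two_hilbertTransformTrunc hf hf2 (window_pos n))
  have h2m : MemLp (fun x => (hilbertTransformTrunc (1 / ((m : ℝ) + 1)) ((m : ℝ) + 1) f x : ℂ)) 2 :=
    memLp_ofReal (memLp_two_hilbertTransformTrunc hf hf2 (window_pos m))
  have hI : Integrable (fun x => (hilbertTransformTrunc (1 / ((n : ℝ) + 1)) ((n : ℝ) + 1) f x : ℂ) -
      (hilbertTransformTrunc (1 / ((m : ℝ) + 1)) ((m : ℝ) + 1) f x : ℂ)) := hIn.sub hIm
  have h2 : MemLp (fun x => (hilbertTransformTrunc (1 / ((n : ℝ) + 1)) ((n : ℝ) + 1) f x : ℂ) -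
      (hilbertTransformTrunc (1 / ((m : ℝ) + 1)) ((m : ℝ) + 1) f x : ℂ)) 2 := h2n.sub h2m
  rw [← lintegral_enorm_sq_fourierIntegral_eq hI h2]
  refine lintegral_congr fun k => ?_
  congr 2
  -- `𝓕 (H_n − H_m) k = 𝓕 H_n k − 𝓕 H_m k = (m_n − m_m) 𝓕 f k`
  have hsub : 𝓕 (fun x => (hilbertTransformTrunc (1 / ((n : ℝ) + 1)) ((n : ℝ) + 1) f x : ℂ) -
      (hilbertTransformTrunc (1 / ((m : ℝ) + 1)) ((m : ℝ) + 1) f x : ℂ)) k =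
      𝓕 (fun x => (hilbertTransformTrunc (1 / ((n : ℝ) + 1)) ((n : ℝ) + 1) f x : ℂ)) k -
        𝓕 (fun x => (hilbertTransformTrunc (1 / ((m : ℝ) + 1)) ((m : ℝ) + 1) f x : ℂ)) k := by
    rw [Real.fourier_real_eq, Real.fourier_real_eq, Real.fourier_real_eq, ← integral_sub]
    · refine integral_congr_ae (ae_of_all _ fun v => ?_)
      simp only [smul_sub]
    · exact integrable_fourierChar_smul hIn k
    · exact integrable_fourierChar_smul hIm k
  rw [hsub, fourier_hilbertTransformTrunc hf (window_pos n) (window_le n),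
    fourier_hilbertTransformTrunc hf (window_pos m) (window_le m)]
  ring

/-! ### The isometry -/

/-- **The Hilbert transform is an `L²` isometry** (M. Riesz `p = 2` / Plancherel): for a real
`f ∈ L¹(ℝ) ∩ L²(ℝ)` whose symmetric p.v. integrand is integrable on `(0,∞)` at a.e. `x`, the pointwise
Hilbert transform `hilbertTransform f` is in `L²` and `‖Hf‖_{L²} = ‖f‖_{L²}`.
[cite: Grafakos2014, eq. (5.1.14) and Thm. 5.1.7 (case p = 2)] -/
theorem memLp_two_hilbertTransform_and_eLpNorm_eq {f : ℝ → ℝ} (hf : Integrable f) (hf2 : MemLp f 2)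
    (hint : ∀ᵐ x : ℝ, IntegrableOn (fun t => (f (x - t) - f (x + t)) / t) (Ioi 0)) :
    MemLp (hilbertTransform f) 2 ∧ eLpNorm (hilbertTransform f) 2 volume = eLpNorm f 2 volume := by
  -- the complexified truncations `u n` and their a.e. limit `v = Hf`
  have hu : ∀ n : ℕ, AEStronglyMeasurable
      (fun x => (hilbertTransformTrunc (1 / ((n : ℝ) + 1)) ((n : ℝ) + 1) f x : ℂ)) volume := fun n =>
    (integrable_hilbertTransformTrunc hf (window_pos n) (R := (n : ℝ) + 1)).ofReal.aestronglyMeasurable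
  have hlim : ∀ᵐ x : ℝ, Tendsto (fun n : ℕ => (hilbertTransformTrunc (1 / ((n : ℝ) + 1)) ((n : ℝ) + 1) f x : ℂ))
      atTop (𝓝 (hilbertTransform f x : ℂ)) := by
    filter_upwards [hint] with x hx
    exact (Complex.continuous_ofReal.tendsto _).comp (tendsto_hilbertTransformTrunc hx)
  have hv : AEStronglyMeasurable (fun x => (hilbertTransform f x : ℂ)) volume :=
    aestronglyMeasurable_of_tendsto_ae atTop hu hlim
  -- `L²`-Cauchy: `∫ ‖u n − u m‖ₑ² ≤ 2Aₙ + 2Aₘ`, `Aₙ → 0`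
  have hcau : ∀ n m : ℕ, (∫⁻ x, ‖(hilbertTransformTrunc (1 / ((n : ℝ) + 1)) ((n : ℝ) + 1) f x : ℂ) -
        (hilbertTransformTrunc (1 / ((m : ℝ) + 1)) ((m : ℝ) + 1) f x : ℂ)‖ₑ ^ 2) ≤
      2 * (∫⁻ k, ‖((((-(2 / π * (sinIntegral (2 * π * k * ((n : ℝ) + 1)) -
          sinIntegral (2 * π * k * (1 / ((n : ℝ) + 1)))))) : ℝ) : ℂ) * I -
        (((-Real.sign k) : ℝ) : ℂ) * I) * 𝓕 (fun x => (f x : ℂ)) k‖ₑ ^ 2) +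
      2 * (∫⁻ k, ‖((((-(2 / π * (sinIntegral (2 * π * k * ((m : ℝ) + 1)) -
          sinIntegral (2 * π * k * (1 / ((m : ℝ) + 1)))))) : ℝ) : ℂ) * I -
        (((-Real.sign k) : ℝ) : ℂ) * I) * 𝓕 (fun x => (f x : ℂ)) k‖ₑ ^ 2) := by
    intro n m
    rw [lintegral_trunc_sub_trunc_sq hf hf2 n m]
    exact lintegral_multiplier_sub_sq_le hf n m
  have hA := tendsto_lintegral_multiplier_sub_lim hf hf2
  have hD := tendsto_lintegral_sub_sq_of_cauchy hu hlim hcau hA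
  have hT := tendsto_eLpNorm_sub_of_lintegral hD
  -- `v = Hf` is in `L²`: `v = u n − (u n − v)` with the difference eventually of finite `L²` norm
  have hvfin : eLpNorm (fun x => (hilbertTransform f x : ℂ)) 2 volume < ⊤ := by
    have hev : ∀ᶠ n : ℕ in atTop, eLpNorm (fun x =>
        (hilbertTransformTrunc (1 / ((n : ℝ) + 1)) ((n : ℝ) + 1) f x : ℂ) - (hilbertTransform f x : ℂ)) 2 volume
        < 1 := (tendsto_order.1 hT).2 1 (by norm_num)
    obtain ⟨n, hn⟩ := hev.exists
    have h2n : MemLp (fun x => (hilbertTransformTrunc (1 / ((n : ℝ) + 1)) ((n : ℝ) + 1) f x : ℂ)) 2 :=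
      memLp_ofReal (memLp_two_hilbertTransformTrunc hf hf2 (window_pos n))
    have heq : (fun x => (hilbertTransform f x : ℂ)) = fun x =>
        (hilbertTransformTrunc (1 / ((n : ℝ) + 1)) ((n : ℝ) + 1) f x : ℂ) -
        ((hilbertTransformTrunc (1 / ((n : ℝ) + 1)) ((n : ℝ) + 1) f x : ℂ) - (hilbertTransform f x : ℂ)) := by
      funext x; ring
    rw [heq]
    refine lt_of_le_of_lt (eLpNorm_sub_le h2n.1 ((hu n).sub hv) (by norm_num)) ?_
    exact ENNReal.add_lt_top.2 ⟨h2n.eLpNorm_lt_top, hn.trans ENNReal.one_lt_top⟩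
  -- `‖u n‖₂ → ‖v‖₂` and `‖u n‖₂ → ‖f‖₂`
  have hE := tendsto_eLpNorm_of_tendsto_sub hu hv hvfin.ne hT
  have hE' : Tendsto (fun n : ℕ => eLpNorm
      (fun x => (hilbertTransformTrunc (1 / ((n : ℝ) + 1)) ((n : ℝ) + 1) f x : ℂ)) 2 volume) atTop
      (𝓝 (eLpNorm f 2 volume)) := by
    have hrw : ∀ n : ℕ, eLpNorm (fun x => (hilbertTransformTrunc (1 / ((n : ℝ) + 1)) ((n : ℝ) + 1) f x : ℂ))
        2 volume = (∫⁻ k, ‖(((-(2 / π * (sinIntegral (2 * π * k * ((n : ℝ) + 1)) -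
          sinIntegral (2 * π * k * (1 / ((n : ℝ) + 1)))))) : ℝ) : ℂ) * I *
        𝓕 (fun x => (f x : ℂ)) k‖ₑ ^ 2) ^ (1 / (2 : ℝ)) := by
      intro n
      have hIn : Integrable (fun x => (hilbertTransformTrunc (1 / ((n : ℝ) + 1)) ((n : ℝ) + 1) f x : ℂ)) :=
        (integrable_hilbertTransformTrunc hf (window_pos n)).ofReal
      have h2n : MemLp (fun x => (hilbertTransformTrunc (1 / ((n : ℝ) + 1)) ((n : ℝ) + 1) f x : ℂ)) 2 :=
        memLp_ofReal (memLp_two_hilbertTransformTrunc hf hf2 (window_pos n))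
      rw [eLpNorm_eq_lintegral_rpow_enorm_toReal two_ne_zero ENNReal.ofNat_ne_top]
      simp only [ENNReal.toReal_ofNat, ENNReal.rpow_two]
      rw [← lintegral_enorm_sq_fourierIntegral_eq hIn h2n]
      congr 1
      refine lintegral_congr fun k => ?_
      rw [fourier_hilbertTransformTrunc hf (window_pos n) (window_le n)]
    simp_rw [hrw]
    have hf2' : eLpNorm f 2 volume = (∫⁻ x, ‖f x‖ₑ ^ 2) ^ (1 / (2 : ℝ)) := by
      rw [eLpNorm_eq_lintegral_rpow_enorm_toReal two_ne_zero ENNReal.ofNat_ne_top]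
      simp only [ENNReal.toReal_ofNat, ENNReal.rpow_two]
    rw [hf2']
    exact (ENNReal.continuous_rpow_const.tendsto _).comp (tendsto_lintegral_multiplier_sq hf hf2)
  have hEq : eLpNorm (fun x => (hilbertTransform f x : ℂ)) 2 volume = eLpNorm f 2 volume :=
    tendsto_nhds_unique hE hE'
  -- back to the real-valued function
  have hreal : eLpNorm (hilbertTransform f) 2 volume = eLpNorm (fun x => (hilbertTransform f x : ℂ)) 2 volume :=
    eLpNorm_congr_norm_ae (ae_of_all _ fun x => by rw [Complex.norm_real])
  have hmeasR : AEStronglyMeasurable (hilbertTransform f) volume := by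
    have hu' : ∀ n : ℕ, AEStronglyMeasurable
        (fun x => hilbertTransformTrunc (1 / ((n : ℝ) + 1)) ((n : ℝ) + 1) f x) volume := fun n =>
      (integrable_hilbertTransformTrunc hf (window_pos n) (R := (n : ℝ) + 1)).aestronglyMeasurable
    have hlim' : ∀ᵐ x : ℝ, Tendsto (fun n : ℕ => hilbertTransformTrunc (1 / ((n : ℝ) + 1)) ((n : ℝ) + 1) f x)
        atTop (𝓝 (hilbertTransform f x)) := by
      filter_upwards [hint] with x hx using tendsto_hilbertTransformTrunc hx
    exact aestronglyMeasurable_of_tendsto_ae atTop hu' hlim'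
  refine ⟨⟨hmeasR, ?_⟩, ?_⟩
  · rw [hreal, hEq]; exact hf2.eLpNorm_lt_top
  · rw [hreal, hEq]

/-- **`‖Hf‖_{L²} = ‖f‖_{L²}`** for real `f ∈ L¹ ∩ L²` with a.e.-integrable symmetric p.v. integrand.
[cite: Grafakos2014, eq. (5.1.14)] -/
theorem eLpNorm_hilbertTransform_eq {f : ℝ → ℝ} (hf : Integrable f) (hf2 : MemLp f 2)
    (hint : ∀ᵐ x : ℝ, IntegrableOn (fun t => (f (x - t) - f (x + t)) / t) (Ioi 0)) :
    eLpNorm (hilbertTransform f) 2 volume = eLpNorm f 2 volume :=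
  (memLp_two_hilbertTransform_and_eLpNorm_eq hf hf2 hint).2

/-- **`Hf ∈ L²`** for real `f ∈ L¹ ∩ L²` with a.e.-integrable symmetric p.v. integrand.
[cite: Grafakos2014, eq. (5.1.14) and Thm. 5.1.7 (case p = 2)] -/
theorem memLp_two_hilbertTransform {f : ℝ → ℝ} (hf : Integrable f) (hf2 : MemLp f 2)
    (hint : ∀ᵐ x : ℝ, IntegrableOn (fun t => (f (x - t) - f (x + t)) / t) (Ioi 0)) :
    MemLp (hilbertTransform f) 2 :=
  (memLp_two_hilbertTransform_and_eLpNorm_eq hf hf2 hint).1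

/-- **Integral form**: `∫ (Hf)² = ∫ f²` for real `f ∈ L¹ ∩ L²` with a.e.-integrable symmetric p.v. integrand.
[cite: Grafakos2014, eq. (5.1.14)] -/
theorem integral_hilbertTransform_sq_eq {f : ℝ → ℝ} (hf : Integrable f) (hf2 : MemLp f 2)
    (hint : ∀ᵐ x : ℝ, IntegrableOn (fun t => (f (x - t) - f (x + t)) / t) (Ioi 0)) :
    ∫ x, (hilbertTransform f x) ^ 2 = ∫ x, (f x) ^ 2 := by
  have hH := memLp_two_hilbertTransform hf hf2 hint
  have h := eLpNorm_hilbertTransform_eq hf hf2 hint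
  rw [eLpNorm_eq_lintegral_rpow_enorm_toReal two_ne_zero ENNReal.ofNat_ne_top,
    eLpNorm_eq_lintegral_rpow_enorm_toReal two_ne_zero ENNReal.ofNat_ne_top] at h
  simp only [ENNReal.toReal_ofNat, one_div, ENNReal.rpow_two] at h
  have h' : (∫⁻ x, ‖hilbertTransform f x‖ₑ ^ 2) = ∫⁻ x, ‖f x‖ₑ ^ 2 := by
    have h2 := congrArg (fun x : ℝ≥0∞ => x ^ (2 : ℝ)) h
    simp only [← ENNReal.rpow_mul, show (2 : ℝ)⁻¹ * 2 = 1 by norm_num, ENNReal.rpow_one] at h2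
    exact h2
  rw [integral_eq_lintegral_of_nonneg_ae (ae_of_all _ fun x => sq_nonneg _)
      hH.integrable_sq.aestronglyMeasurable,
    integral_eq_lintegral_of_nonneg_ae (ae_of_all _ fun x => sq_nonneg _)
      hf2.integrable_sq.aestronglyMeasurable]
  have e : ∀ (g : ℝ → ℝ) (x : ℝ), ENNReal.ofReal (g x ^ 2) = ‖g x‖ₑ ^ 2 := fun g x => by
    rw [← ofReal_norm, Real.norm_eq_abs, ← ENNReal.ofReal_pow (abs_nonneg _), sq_abs]
  simp_rw [e, h']

/-- **`C¹` version**: for `f ∈ C¹(ℝ) ∩ L¹ ∩ L²` the symmetric integrand is integrable at every point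
(`integrableOn_symmIntegrand_of_contDiff`), so `Hf ∈ L²` and `‖Hf‖_{L²} = ‖f‖_{L²}`.
[cite: Grafakos2014, eq. (5.1.14) with Rmk. 5.1.2] -/
theorem eLpNorm_hilbertTransform_eq_of_contDiff {f : ℝ → ℝ} (hf : ContDiff ℝ 1 f) (hfi : Integrable f)
    (hf2 : MemLp f 2) :
    MemLp (hilbertTransform f) 2 ∧ eLpNorm (hilbertTransform f) 2 volume = eLpNorm f 2 volume :=
  memLp_two_hilbertTransform_and_eLpNorm_eq hfi hf2
    (ae_of_all _ fun x => integrableOn_symmIntegrand_of_contDiff hf hfi x)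

/-- **`L²` convergence of the truncations** (exported form of the step inside `memLp_two_hilbertTransform_and_eLpNorm_eq`):
for real `f ∈ L¹ ∩ L²` with a.e.-integrable symmetric p.v. integrand, `‖H_{1/(n+1), n+1} f − Hf‖_{L²} → 0`.
[cite: Grafakos2014, Rmk. 5.1.6 («the expressions H^{(ε)}(f) converge a.e. (and also in L^p when p > 1)»)] -/
theorem tendsto_eLpNorm_hilbertTransformTrunc_sub {f : ℝ → ℝ} (hf : Integrable f) (hf2 : MemLp f 2)
    (hint : ∀ᵐ x : ℝ, IntegrableOn (fun t => (f (x - t) - f (x + t)) / t) (Ioi 0)) :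
    Tendsto (fun n : ℕ => eLpNorm (fun x => hilbertTransformTrunc (1 / ((n : ℝ) + 1)) ((n : ℝ) + 1) f x -
      hilbertTransform f x) 2 volume) atTop (𝓝 0) := by
  -- complexified truncations, a.e. limit, Cauchy bound, Fatou (as in the isometry proof)
  have hu : ∀ n : ℕ, AEStronglyMeasurable
      (fun x => (hilbertTransformTrunc (1 / ((n : ℝ) + 1)) ((n : ℝ) + 1) f x : ℂ)) volume := fun n =>
    (integrable_hilbertTransformTrunc hf (window_pos n) (R := (n : ℝ) + 1)).ofReal.aestronglyMeasurable
  have hlim : ∀ᵐ x : ℝ, Tendsto (fun n : ℕ => (hilbertTransformTrunc (1 / ((n : ℝ) + 1)) ((n : ℝ) + 1) f x : ℂ))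
      atTop (𝓝 (hilbertTransform f x : ℂ)) := by
    filter_upwards [hint] with x hx
    exact (Complex.continuous_ofReal.tendsto _).comp (tendsto_hilbertTransformTrunc hx)
  have hcau : ∀ n m : ℕ, (∫⁻ x, ‖(hilbertTransformTrunc (1 / ((n : ℝ) + 1)) ((n : ℝ) + 1) f x : ℂ) -
        (hilbertTransformTrunc (1 / ((m : ℝ) + 1)) ((m : ℝ) + 1) f x : ℂ)‖ₑ ^ 2) ≤
      2 * (∫⁻ k, ‖((((-(2 / π * (sinIntegral (2 * π * k * ((n : ℝ) + 1)) -
          sinIntegral (2 * π * k * (1 / ((n : ℝ) + 1)))))) : ℝ) : ℂ) * I -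
        (((-Real.sign k) : ℝ) : ℂ) * I) * 𝓕 (fun x => (f x : ℂ)) k‖ₑ ^ 2) +
      2 * (∫⁻ k, ‖((((-(2 / π * (sinIntegral (2 * π * k * ((m : ℝ) + 1)) -
          sinIntegral (2 * π * k * (1 / ((m : ℝ) + 1)))))) : ℝ) : ℂ) * I -
        (((-Real.sign k) : ℝ) : ℂ) * I) * 𝓕 (fun x => (f x : ℂ)) k‖ₑ ^ 2) := by
    intro n m
    rw [lintegral_trunc_sub_trunc_sq hf hf2 n m]
    exact lintegral_multiplier_sub_sq_le hf n m
  have hD := tendsto_lintegral_sub_sq_of_cauchy hu hlim hcau (tendsto_lintegral_multiplier_sub_lim hf hf2)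
  have hT := tendsto_eLpNorm_sub_of_lintegral hD
  -- back to the real-valued differences (same pointwise norm)
  refine hT.congr fun n => ?_
  refine eLpNorm_congr_norm_ae (ae_of_all _ fun x => ?_)
  rw [← Complex.ofReal_sub, Complex.norm_real]

end Literature.Analysis.Fourier
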